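import Mathlib.Analysis.SpecialFunctions.Sqrt
import Mathlib.Analysis.InnerProductSpace.Calculus
import Literature.Geometry.Lorentzian.Genericity

/-!
# Local families suffice for Christodoulou's finite-codimension genericity
# (negative-side support for the crux `WeakCosmicCensorshipMGHD`, item `stmt-FinalStateConjecture-9952`)

`InitialDataSet.HasCodimAtLeastIn 𝓓 𝓔 m` (`Genericity.lean`) asks, through every exceptional
datum `d`, for a jointly smooth family `F : ℝᵐ → InitialDataSet I X` which is injective on ALL of
`ℝᵐ`, admissible for ALL parameters and meets `𝓔` only at `0`. This file proves that the GLOBAL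
requirements are harmless: a family that is injective, admissible and `𝓔`-free only on a small
ball `B(0, ε)` can be reparametrised by the smooth injective squashing map
`c ↦ (ε / √(1 + ‖c‖²)) c : ℝᵐ → B(0, ε)` into a global one (`hasCodimAtLeastIn_of_local`,
`isChristodoulouGeneric_iff_local`). Consequences for the crux: a PROVER need only produce local
curves; a REFUTER must show that every LOCAL admissible smooth curve through some exceptional datum
re-enters the exceptional set inside every ball (`not_isChristodoulouGeneric_iff_local`).

All results proved; no named facts.

## References

* D. Christodoulou, CQG 16 (1999) A23, p. A24; Ann. Math. 149 (1999) 183, p. 187 (the families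
  of the genericity notion; no globality is intended there).
-/

noncomputable section

open Bundle Set Function Metric
open scoped ContDiff Topology Manifold

namespace Summit.FinalStateConjecture.FinalStateConjecture.Theorems.WeakCosmicCensorshipMGHD.Negative

open Literature.Geometry.Lorentzian

/-! ### The squashing reparametrisation `ℝᵐ → B(0, ε)` -/

section Squash

variable {m : ℕ}

/-- The smooth squashing map `c ↦ (ε / √(1 + ‖c‖²)) • c` of `ℝᵐ` onto the open ball of radius
`ε` (for `ε > 0`), fixing `0`. -/
def squash (ε : ℝ) (c : EuclideanSpace ℝ (Fin m)) : EuclideanSpace ℝ (Fin m) :=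
  (ε / Real.sqrt (1 + ‖c‖ ^ 2)) • c

/-- `0 < 1 + ‖c‖²`. -/
theorem one_add_norm_sq_pos (c : EuclideanSpace ℝ (Fin m)) : 0 < 1 + ‖c‖ ^ 2 := by positivity

/-- The squashing map fixes `0`. -/
@[simp] theorem squash_zero (ε : ℝ) : squash ε (0 : EuclideanSpace ℝ (Fin m)) = 0 := by
  simp [squash]

/-- The norm of the squashed point: `ε ‖c‖ / √(1 + ‖c‖²)`. -/
theorem norm_squash (ε : ℝ) (hε : 0 ≤ ε) (c : EuclideanSpace ℝ (Fin m)) :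
    ‖squash ε c‖ = ε * ‖c‖ / Real.sqrt (1 + ‖c‖ ^ 2) := by
  rw [squash, norm_smul, Real.norm_eq_abs, abs_of_nonneg (by positivity)]
  ring

/-- The squashing map lands in the open ball of radius `ε`. -/
theorem norm_squash_lt {ε : ℝ} (hε : 0 < ε) (c : EuclideanSpace ℝ (Fin m)) : ‖squash ε c‖ < ε := by
  rw [norm_squash ε hε.le, div_lt_iff₀ (Real.sqrt_pos.2 (one_add_norm_sq_pos c))]
  have h : ‖c‖ < Real.sqrt (1 + ‖c‖ ^ 2) := by
    rw [Real.lt_sqrt (norm_nonneg c)]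
    linarith
  nlinarith

/-- Only `0` is squashed to `0`. -/
theorem squash_eq_zero_iff {ε : ℝ} (hε : ε ≠ 0) {c : EuclideanSpace ℝ (Fin m)} :
    squash ε c = 0 ↔ c = 0 := by
  refine ⟨fun h ↦ ?_, fun h ↦ by simp [h]⟩
  rw [squash, smul_eq_zero] at h
  rcases h with h | h
  · exact absurd h (div_ne_zero hε (Real.sqrt_pos.2 (one_add_norm_sq_pos c)).ne')
  · exact h

/-- The radial profile `r ↦ r / √(1 + r²)` is injective on `[0, ∞)`. -/
theorem radial_injOn : InjOn (fun r : ℝ ↦ r / Real.sqrt (1 + r ^ 2)) (Ici 0) := by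
  intro r hr s hs h
  simp only [mem_Ici] at hr hs
  have hr1 : 0 < Real.sqrt (1 + r ^ 2) := Real.sqrt_pos.2 (by positivity)
  have hs1 : 0 < Real.sqrt (1 + s ^ 2) := Real.sqrt_pos.2 (by positivity)
  have h' : r * Real.sqrt (1 + s ^ 2) = s * Real.sqrt (1 + r ^ 2) := by
    field_simp at h
    linarith
  have h2 : r ^ 2 * (1 + s ^ 2) = s ^ 2 * (1 + r ^ 2) := by
    have := congrArg (· ^ 2) h'
    simp only [mul_pow, Real.sq_sqrt (by positivity : (0 : ℝ) ≤ 1 + s ^ 2),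
      Real.sq_sqrt (by positivity : (0 : ℝ) ≤ 1 + r ^ 2)] at this
    exact this
  have h3 : r ^ 2 = s ^ 2 := by nlinarith
  nlinarith [sq_nonneg (r - s), sq_nonneg (r + s), mul_nonneg hr hs]

/-- The squashing map is injective (the radial profile is injective and directions are kept). -/
theorem squash_injective {ε : ℝ} (hε : 0 < ε) : Injective (squash ε : EuclideanSpace ℝ (Fin m) → _) := by
  intro c c' h
  have hn : ‖c‖ = ‖c'‖ := by
    have h1 := congrArg norm h
    rw [norm_squash ε hε.le, norm_squash ε hε.le, mul_div_assoc, mul_div_assoc] at h1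
    exact radial_injOn (norm_nonneg c) (norm_nonneg c') (mul_left_cancel₀ hε.ne' h1)
  rw [squash, squash, hn] at h
  exact smul_right_injective _ (div_ne_zero hε.ne' (Real.sqrt_pos.2 (one_add_norm_sq_pos c')).ne') h

/-- The squashing map is smooth. -/
theorem contDiff_squash (ε : ℝ) : ContDiff ℝ ∞ (squash ε : EuclideanSpace ℝ (Fin m) → _) := by
  have h1 : ContDiff ℝ ∞ fun c : EuclideanSpace ℝ (Fin m) ↦ 1 + ‖c‖ ^ 2 :=
    contDiff_const.add (contDiff_norm_sq ℝ)
  have h2 : ContDiff ℝ ∞ fun c : EuclideanSpace ℝ (Fin m) ↦ Real.sqrt (1 + ‖c‖ ^ 2) :=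
    h1.sqrt fun c ↦ (one_add_norm_sq_pos c).ne'
  exact (contDiff_const.div h2 fun c ↦ (Real.sqrt_pos.2 (one_add_norm_sq_pos c)).ne').smul
    contDiff_id

end Squash

/-! ### Reparametrisation of smooth data families -/

section Families

variable {E : Type*} [NormedAddCommGroup E] [NormedSpace ℝ E] {H : Type*} [TopologicalSpace H]
  {I : ModelWithCorners ℝ E H} {X : Type*} [TopologicalSpace X] [ChartedSpace H X]
  [IsManifold I ∞ X]

/-- **Smooth data families pull back along smooth reparametrisations**: if `F : ℝᵐ → data` is a
jointly smooth family and `φ : ℝᵏ → ℝᵐ` is smooth, `F ∘ φ` is a jointly smooth family. -/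
theorem isSmoothDataFamily_comp {m k : ℕ} {F : EuclideanSpace ℝ (Fin m) → InitialDataSet I X}
    (hF : InitialDataSet.IsSmoothDataFamily m F)
    {φ : EuclideanSpace ℝ (Fin k) → EuclideanSpace ℝ (Fin m)} (hφ : ContDiff ℝ ∞ φ) :
    InitialDataSet.IsSmoothDataFamily k (F ∘ φ) := by
  have hψ : ContMDiff (𝓘(ℝ, EuclideanSpace ℝ (Fin k)).prod I) (𝓘(ℝ, EuclideanSpace ℝ (Fin m)).prod I)
      ∞ (Prod.map φ (id : X → X)) :=
    (contMDiff_iff_contDiff.2 hφ).prodMap contMDiff_id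
  exact ⟨hF.1.comp hψ, hF.2.comp hψ⟩

/-- **Local families suffice.** If through every `d ∈ 𝓔` there is a jointly smooth family
`F : ℝᵐ → data` with `F 0 = d` which, on some ball `B(0, ε)`, is injective, stays in the admissible
class `𝓓` and meets `𝓔` only at the parameter `0`, then `𝓔` has codimension at least `m` inside
`𝓓` in the (global) sense of `HasCodimAtLeastIn`: reparametrise by `squash ε`. -/
theorem hasCodimAtLeastIn_of_local {𝓓 𝓔 : Set (InitialDataSet I X)} {m : ℕ}
    (h : ∀ d ∈ 𝓔, ∃ ε > (0 : ℝ), ∃ F : EuclideanSpace ℝ (Fin m) → InitialDataSet I X,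
      InitialDataSet.IsSmoothDataFamily m F ∧ F 0 = d ∧ InjOn F (ball 0 ε) ∧
        (∀ c ∈ ball (0 : EuclideanSpace ℝ (Fin m)) ε, F c ∈ 𝓓) ∧
        ∀ c ∈ ball (0 : EuclideanSpace ℝ (Fin m)) ε, c ≠ 0 → F c ∉ 𝓔) :
    InitialDataSet.HasCodimAtLeastIn 𝓓 𝓔 m := by
  intro d hd
  obtain ⟨ε, hε, F, hF, h0, hinj, hadm, hexc⟩ := h d hd
  have hmem : ∀ c : EuclideanSpace ℝ (Fin m), squash ε c ∈ ball (0 : EuclideanSpace ℝ (Fin m)) ε :=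
    fun c ↦ mem_ball_zero_iff.2 (norm_squash_lt hε c)
  refine ⟨F ∘ squash ε, isSmoothDataFamily_comp hF (contDiff_squash ε), by simp [h0],
    fun a b hab ↦ squash_injective hε (hinj (hmem a) (hmem b) hab), fun c ↦ hadm _ (hmem c),
    fun c hc ↦ hexc _ (hmem c) ((squash_eq_zero_iff hε.ne').not.2 hc)⟩

/-- The global notion trivially gives local families (any `ε`). -/
theorem local_of_hasCodimAtLeastIn {𝓓 𝓔 : Set (InitialDataSet I X)} {m : ℕ}
    (h : InitialDataSet.HasCodimAtLeastIn 𝓓 𝓔 m) :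
    ∀ d ∈ 𝓔, ∃ ε > (0 : ℝ), ∃ F : EuclideanSpace ℝ (Fin m) → InitialDataSet I X,
      InitialDataSet.IsSmoothDataFamily m F ∧ F 0 = d ∧ InjOn F (ball 0 ε) ∧
        (∀ c ∈ ball (0 : EuclideanSpace ℝ (Fin m)) ε, F c ∈ 𝓓) ∧
        ∀ c ∈ ball (0 : EuclideanSpace ℝ (Fin m)) ε, c ≠ 0 → F c ∉ 𝓔 := by
  intro d hd
  obtain ⟨F, hF, h0, hinj, hadm, hexc⟩ := h d hd
  exact ⟨1, one_pos, F, hF, h0, hinj.injOn, fun c _ ↦ hadm c, fun c _ hc ↦ hexc c hc⟩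

/-- **Christodoulou-genericity is a local property of the exceptional set**: it holds iff through
every admissible exceptional datum there is a jointly smooth family which is injective, admissible
and non-exceptional (off `0`) on SOME ball around the parameter `0`. -/
theorem isChristodoulouGeneric_iff_local {𝓓 : Set (InitialDataSet I X)}
    {P : InitialDataSet I X → Prop} {m : ℕ} :
    InitialDataSet.IsChristodoulouGeneric 𝓓 P m ↔
      ∀ d ∈ 𝓓, ¬ P d → ∃ ε > (0 : ℝ), ∃ F : EuclideanSpace ℝ (Fin m) → InitialDataSet I X,
        InitialDataSet.IsSmoothDataFamily m F ∧ F 0 = d ∧ InjOn F (ball 0 ε) ∧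
          (∀ c ∈ ball (0 : EuclideanSpace ℝ (Fin m)) ε, F c ∈ 𝓓) ∧
          ∀ c ∈ ball (0 : EuclideanSpace ℝ (Fin m)) ε, c ≠ 0 → P (F c) := by
  constructor
  · intro h d hd hP
    obtain ⟨ε, hε, F, hF, h0, hinj, hadm, hexc⟩ := local_of_hasCodimAtLeastIn h d ⟨hd, hP⟩
    refine ⟨ε, hε, F, hF, h0, hinj, hadm, fun c hc hc0 ↦ ?_⟩
    by_contra hPc
    exact hexc c hc hc0 ⟨hadm c hc, hPc⟩
  · intro h
    refine hasCodimAtLeastIn_of_local fun d hd ↦ ?_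
    obtain ⟨ε, hε, F, hF, h0, hinj, hadm, hgood⟩ := h d hd.1 hd.2
    exact ⟨ε, hε, F, hF, h0, hinj, hadm, fun c hc hc0 hmem ↦ hmem.2 (hgood c hc hc0)⟩

/-- **What a refutation must show, local form**: genericity FAILS iff some admissible exceptional
datum is locally trapped — EVERY jointly smooth family through it which is injective and
admissible on a ball has, inside that ball, a nonzero parameter with exceptional value. -/
theorem not_isChristodoulouGeneric_iff_local {𝓓 : Set (InitialDataSet I X)}
    {P : InitialDataSet I X → Prop} {m : ℕ} :
    ¬ InitialDataSet.IsChristodoulouGeneric 𝓓 P m ↔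
      ∃ d ∈ 𝓓, ¬ P d ∧ ∀ (ε : ℝ), 0 < ε → ∀ F : EuclideanSpace ℝ (Fin m) → InitialDataSet I X,
        InitialDataSet.IsSmoothDataFamily m F → F 0 = d → InjOn F (ball 0 ε) →
          (∀ c ∈ ball (0 : EuclideanSpace ℝ (Fin m)) ε, F c ∈ 𝓓) →
          ∃ c ∈ ball (0 : EuclideanSpace ℝ (Fin m)) ε, c ≠ 0 ∧ ¬ P (F c) := by
  rw [isChristodoulouGeneric_iff_local]
  push Not
  rfl

end Families

end Summit.FinalStateConjecture.FinalStateConjecture.Theorems.WeakCosmicCensorshipMGHD.Negative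

end
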